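import Literature.Analysis.FluidPDE.PlanarPullbackTransport
import HarnessLib

/-!
# Graph-band moves in the plane (explicit Eulerian kinematics of a deforming graph band)

Topic `Literature/Analysis/FluidPDE`. Continuation of `PlanarPullbackKinematics.lean` /
`PlanarPullbackTransport.lean` (the pullback calculus for explicit solutions of the planar
transport equation behind `QuasiSelfSimilar.IsCompatibleBlockSystem`). Those files give the two
primitive moves of a straight channel: shears `Ψ = (x, y - φ(t,x))` and axial stretches
`Ψ = (Ξ(t,x), c + (y-c)/∂ₓΞ)`. This file gives their common generalisation, the **graph-band
move**: a channel that is, at every time, a band around the graph `y = T(t, x)` whose material is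
redistributed along the axis by a reparametrisation `x ↦ Ξ(t, x)`:

* material coordinates `Ψ(t, (x, y)) = (Ξ(t, x), (y - T(t, x))/∂ₓΞ(t, x))` (`graphPullback`;
  Jacobian `∂ₓΞ · (∂ₓΞ)⁻¹ = 1`), so that a reference profile `Θ_ref(X, Y) = G(Y)` (a straight band
  around `{Y = 0}`) is carried to `Θ(t, (x, y)) = G((y - T(t,x))/∂ₓΞ(t,x))` — the band around the
  moving graph with half-width multiplied by `∂ₓΞ(t, x)`;
* Eulerian velocity `V = (g, ∂ₜT + g ∂ₓT - (y - T) ∂ₓg)` with the rate `g = -∂ₜΞ/∂ₓΞ`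
  (`graphVelocity`; for `T ≡ 0` the axial velocity, for `Ξ = id` the vertical shear velocity);
* its stream function `H = g (y - T) - P`, `∂ₓP = ∂ₜT` (`graphStream`, `V = (∂_yH, -∂ₓH)`,
  `graphVelocity_eq_perp_fderiv_graphStream`), which is what the gluing of several simultaneous
  moves through cut-offs consumes;
* the pullback identity `∂ₜΨ + D_zΨ[V] = 0` (`graph_pullback_identity`), incompressibility
  (`divergence_graphVelocity`), transport of every profile composed with `Ψ`
  (`transport_comp_graphPullback`), smoothness from the one-dimensional data
  (`contDiff_uncurry_graphPullback`, `…Velocity`, `…Stream`), and the reductions to the two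
  primitives (`graphPullback_zero_profile`, `graphPullback_id_material`, …).

As in the parent files the data are the profile `T`, the reparametrisation `Ξ` and their partial
derivatives as explicit functions (so that closed forms can be supplied), with pointwise
`HasDerivAt` hypotheses linking them. Conjugating by the symmetries of the square and by the two
diagonal frames `(x - y, x + y)` (linear maps of constant Jacobian) turns this single element into
the bands around graphs over any of the four directions — straight runs, corners (graphs over the
bisecting diagonal) and their births by graph shears, tapers and reservoirs (non-constant `∂ₓΞ`),
in-place rescaling of a corner (`Ξ(t,·)` affine near the apex) — of an explicit rectilinear
isotopy; this is the element from which a discharge of `acm_compatible_blocks`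
(`QuasiSelfSimilarCompatibleBlocks.lean`; Alberti–Crippa–Mazzucato, JAMS 32 (2019), §8.9–8.11 give
the two generating moves by figures) is to be assembled. The file states no named fact.

The formulas are the Eulerian reading of the method of characteristics (folklore); the role model
is the tubular construction of Alberti–Crippa–Mazzucato, §7 (fields attached to a moving curve),
here for graphs, where everything is in closed form.

## References

* G. Alberti, G. Crippa, A. L. Mazzucato, *Exponential self-similar mixing by incompressible
  flows*, J. Amer. Math. Soc. 32 (2019), 445–490, §§7–8 (arXiv:1605.02090).
* E. Bruè, C. De Lellis, *Anomalous dissipation for the forced 3D Navier–Stokes equations*,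
  Comm. Math. Phys. 400 (2023), 1507–1533, §4 (arXiv:2207.06301).
-/

noncomputable section

open Function Set Filter
open scoped Topology

namespace Literature.Analysis.FluidPDE

namespace PlanarKinematics

/-- The plane `ℝ²` as a Euclidean space. [folklore] -/
local notation "E²" => EuclideanSpace ℝ (Fin 2)

variable {G : Type*} [NormedAddCommGroup G] [NormedSpace ℝ G]

/-! ## The graph-band move: definitions -/

/-- **Graph band, material coordinates**: `Ψ(t, (x, y)) = (Ξ(t, x), (y - T(t, x))/Ξₓ(t, x))`
(`Ξx` is the datum for `∂ₓΞ`): the area-preserving map carrying the band around the graph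
`y = T(t,x)`, with material redistributed along the axis by `Ξ(t,·)`, back to the straight
reference band around `{Y = 0}`. [folklore] -/
def graphPullback (T Ξ Ξx : ℝ → ℝ → ℝ) (t : ℝ) (w : E²) : E² :=
  vec2 (Ξ t (w 0)) ((w 1 - T t (w 0)) / Ξx t (w 0))

/-- **Graph band, velocity**: `V(t, (x, y)) = (g, Tₜ + Tₓ g - (y - T) gₓ)` with the Eulerian rate
`g = -Ξₜ/Ξₓ` (`axialRate`) and its `x`-derivative `gₓ` (`axialRateDeriv`); the data are
`g, gₓ, T, Tₜ, Tₓ`. [folklore] -/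
def graphVelocity (g gx T Tt Tx : ℝ → ℝ → ℝ) (t : ℝ) (w : E²) : E² :=
  vec2 (g t (w 0)) (Tt t (w 0) + Tx t (w 0) * g t (w 0) - (w 1 - T t (w 0)) * gx t (w 0))

/-- **Graph band, stream function**: `H(t, (x, y)) = g(t,x)(y - T(t,x)) - P(t,x)` where `P(t,·)`
is an antiderivative of `∂ₜT(t,·)`; then `V = (∂_yH, -∂ₓH)`
(`graphVelocity_eq_perp_fderiv_graphStream`). [folklore] -/
def graphStream (g T P : ℝ → ℝ → ℝ) (t : ℝ) (w : E²) : ℝ :=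
  g t (w 0) * (w 1 - T t (w 0)) - P t (w 0)

/-- Unfolding the graph-band pullback. [folklore] -/
@[simp]
theorem graphPullback_apply (T Ξ Ξx : ℝ → ℝ → ℝ) (t : ℝ) (w : E²) :
    graphPullback T Ξ Ξx t w = vec2 (Ξ t (w 0)) ((w 1 - T t (w 0)) / Ξx t (w 0)) := rfl

/-- Unfolding the graph-band velocity. [folklore] -/
@[simp]
theorem graphVelocity_apply (g gx T Tt Tx : ℝ → ℝ → ℝ) (t : ℝ) (w : E²) :
    graphVelocity g gx T Tt Tx t w =
      vec2 (g t (w 0)) (Tt t (w 0) + Tx t (w 0) * g t (w 0) - (w 1 - T t (w 0)) * gx t (w 0)) :=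
  rfl

/-- Unfolding the graph-band stream function. [folklore] -/
@[simp]
theorem graphStream_apply (g T P : ℝ → ℝ → ℝ) (t : ℝ) (w : E²) :
    graphStream g T P t w = g t (w 0) * (w 1 - T t (w 0)) - P t (w 0) := rfl

/-! ## Reductions to the two primitive moves -/

/-- **A straight reference graph gives the axial stretch**: for `T ≡ 0` the graph-band pullback is
the axial pullback about the axis `{y = 0}`. [folklore] -/
theorem graphPullback_zero_profile (Ξ Ξx : ℝ → ℝ → ℝ) (t : ℝ) (w : E²) :
    graphPullback (fun _ _ => 0) Ξ Ξx t w = axialPullback Ξ Ξx 0 t w := by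
  rw [graphPullback_apply, axialPullback_apply, sub_zero, zero_add]

/-- **No redistribution gives the vertical shear**: if `Ξ(t, ·) = id` (and the datum `Ξₓ(t,·) = 1`)
the graph-band pullback is the vertical shear pullback by `T`. [folklore] -/
theorem graphPullback_id_material {T Ξ Ξx : ℝ → ℝ → ℝ} {t : ℝ} (hΞ : ∀ x, Ξ t x = x)
    (hΞx : ∀ x, Ξx t x = 1) (w : E²) : graphPullback T Ξ Ξx t w = vShearPullback T t w := by
  rw [graphPullback_apply, vShearPullback_apply, hΞ, hΞx, div_one]

/-- For `T ≡ 0` (with vanishing data `Tₜ, Tₓ`) the graph-band velocity is the axial velocity about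
`{y = 0}`. [folklore] -/
theorem graphVelocity_zero_profile (g gx : ℝ → ℝ → ℝ) (t : ℝ) (w : E²) :
    graphVelocity g gx (fun _ _ => 0) (fun _ _ => 0) (fun _ _ => 0) t w = axialVelocity g gx 0 t w := by
  rw [graphVelocity_apply, axialVelocity_apply, vec2_eq_vec2_iff]
  exact ⟨rfl, by ring⟩

/-- For a vanishing rate (`g ≡ 0`, `gₓ ≡ 0`: no redistribution) the graph-band velocity is the
vertical shear velocity `(0, Tₜ)`. [folklore] -/
theorem graphVelocity_zero_rate (T Tt Tx : ℝ → ℝ → ℝ) (t : ℝ) (w : E²) :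
    graphVelocity (fun _ _ => 0) (fun _ _ => 0) T Tt Tx t w = vShearVelocity Tt t w := by
  rw [graphVelocity_apply, vShearVelocity_apply, vec2_eq_vec2_iff]
  exact ⟨rfl, by ring⟩

/-- On the graph (`y = T(t, x)`) the pullback is the one-dimensional map `(Ξ(t,x), 0)`. [folklore] -/
theorem graphPullback_apply_graph {T Ξ Ξx : ℝ → ℝ → ℝ} {t : ℝ} {w : E²} (h : w 1 = T t (w 0)) :
    graphPullback T Ξ Ξx t w = vec2 (Ξ t (w 0)) 0 := by
  rw [graphPullback_apply, h, sub_self, zero_div]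

/-- Where nothing has moved yet (`Ξ(t,x) = x`, `Ξₓ(t,x) = 1`, `T(t,x) = 0`) the pullback fixes the
point. [folklore] -/
theorem graphPullback_eq_self {T Ξ Ξx : ℝ → ℝ → ℝ} {t : ℝ} {w : E²} (hΞ : Ξ t (w 0) = w 0)
    (hΞx : Ξx t (w 0) = 1) (hT : T t (w 0) = 0) : graphPullback T Ξ Ξx t w = w := by
  rw [graphPullback_apply, hΞ, hΞx, hT, sub_zero, div_one, vec2_apply_eq]

/-- Where the rate and its derivative vanish and the graph is static to first order
(`Tₜ(t,x) = 0`), the velocity vanishes. [folklore] -/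
theorem graphVelocity_eq_zero {g gx T Tt Tx : ℝ → ℝ → ℝ} {t : ℝ} {w : E²} (hg : g t (w 0) = 0)
    (hgx : gx t (w 0) = 0) (hTt : Tt t (w 0) = 0) : graphVelocity g gx T Tt Tx t w = 0 := by
  rw [graphVelocity_apply, hg, hgx, hTt, mul_zero, mul_zero, add_zero, sub_zero, vec2_eq_zero_iff]
  exact ⟨rfl, rfl⟩

/-! ## Derivatives of the pullback -/

/-- **Time derivative of the graph-band pullback**:
`∂ₜΨ(t,z) = (Ξₜ, -Tₜ/Ξₓ + (z₁ - T)(-Ξₓₜ/Ξₓ²))`. [folklore] -/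
theorem hasDerivAt_graphPullback {T Tt Ξ Ξx Ξt Ξxt : ℝ → ℝ → ℝ} {t : ℝ} {z : E²}
    (hT : HasDerivAt (fun s => T s (z 0)) (Tt t (z 0)) t)
    (ht : HasDerivAt (fun s => Ξ s (z 0)) (Ξt t (z 0)) t)
    (hxt : HasDerivAt (fun s => Ξx s (z 0)) (Ξxt t (z 0)) t) (hne : Ξx t (z 0) ≠ 0) :
    HasDerivAt (fun s => graphPullback T Ξ Ξx s z)
      (vec2 (Ξt t (z 0))
        (-Tt t (z 0) * (Ξx t (z 0))⁻¹ + (z 1 - T t (z 0)) * (-Ξxt t (z 0) / Ξx t (z 0) ^ 2))) t := by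
  have hinvt : HasDerivAt (fun s => (Ξx s (z 0))⁻¹) (-Ξxt t (z 0) / Ξx t (z 0) ^ 2) t :=
    hxt.fun_inv hne
  have hsub : HasDerivAt (fun s => z 1 - T s (z 0)) (-Tt t (z 0)) t := hT.const_sub (z 1)
  have h := hasDerivAt_vec2 ht (hsub.mul hinvt)
  have hfun : (fun s => graphPullback T Ξ Ξx s z) =
      fun s => vec2 (Ξ s (z 0)) ((z 1 - T s (z 0)) * (Ξx s (z 0))⁻¹) := by
    funext s; rw [graphPullback_apply, div_eq_mul_inv]
  rw [hfun]
  exact h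

/-- **Space derivative of the graph-band pullback**:
`D_zΨ(t,z)[v] = (Ξₓ v₀, (-Tₓ/Ξₓ + (z₁ - T)(-Ξₓₓ/Ξₓ²)) v₀ + v₁/Ξₓ)`. [folklore] -/
theorem hasFDerivAt_graphPullback {T Tx Ξ Ξx Ξxx : ℝ → ℝ → ℝ} {t : ℝ} {z : E²}
    (hTx : HasDerivAt (T t) (Tx t (z 0)) (z 0))
    (hx : HasDerivAt (Ξ t) (Ξx t (z 0)) (z 0)) (hxx : HasDerivAt (Ξx t) (Ξxx t (z 0)) (z 0))
    (hne : Ξx t (z 0) ≠ 0) :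
    HasFDerivAt (graphPullback T Ξ Ξx t)
      ((Ξx t (z 0) • (EuclideanSpace.proj (0 : Fin 2) : E² →L[ℝ] ℝ) +
          (0 : ℝ) • (EuclideanSpace.proj (1 : Fin 2) : E² →L[ℝ] ℝ)).smulRight
          (EuclideanSpace.single 0 1) +
        ((-Tx t (z 0) * (Ξx t (z 0))⁻¹ + (z 1 - T t (z 0)) * (-Ξxx t (z 0) / Ξx t (z 0) ^ 2)) •
              (EuclideanSpace.proj (0 : Fin 2) : E² →L[ℝ] ℝ) +
            (Ξx t (z 0))⁻¹ • (EuclideanSpace.proj (1 : Fin 2) : E² →L[ℝ] ℝ)).smulRight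
          (EuclideanSpace.single 1 1)) z := by
  have hinvx : HasDerivAt (fun a => (Ξx t a)⁻¹) (-Ξxx t (z 0) / Ξx t (z 0) ^ 2) (z 0) :=
    hxx.fun_inv hne
  have hgP : DifferentiableAt ℝ (uncurry fun a _ : ℝ => Ξ t a) (z 0, z 1) :=
    hx.differentiableAt.comp (z 0, z 1) differentiableAt_fst
  have hP : HasFDerivAt (fun w : E² => Ξ t (w 0))
      (Ξx t (z 0) • (EuclideanSpace.proj (0 : Fin 2) : E² →L[ℝ] ℝ) +
        (0 : ℝ) • (EuclideanSpace.proj (1 : Fin 2) : E² →L[ℝ] ℝ)) z :=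
    hasFDerivAt_coordFun (g := fun a _ : ℝ => Ξ t a) hgP hx (hasDerivAt_const (z 1) _)
  have hgQ : DifferentiableAt ℝ (uncurry fun a b : ℝ => (b - T t a) * (Ξx t a)⁻¹) (z 0, z 1) := by
    have h1 : DifferentiableAt ℝ (fun p : ℝ × ℝ => Ξx t p.1) (z 0, z 1) :=
      hxx.differentiableAt.comp (z 0, z 1) differentiableAt_fst
    have h2 : DifferentiableAt ℝ (fun p : ℝ × ℝ => T t p.1) (z 0, z 1) :=
      hTx.differentiableAt.comp (z 0, z 1) differentiableAt_fst
    exact (differentiableAt_snd.sub h2).mul (h1.fun_inv hne)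
  have hQ : HasFDerivAt (fun w : E² => (w 1 - T t (w 0)) * (Ξx t (w 0))⁻¹)
      ((-Tx t (z 0) * (Ξx t (z 0))⁻¹ + (z 1 - T t (z 0)) * (-Ξxx t (z 0) / Ξx t (z 0) ^ 2)) •
          (EuclideanSpace.proj (0 : Fin 2) : E² →L[ℝ] ℝ) +
        (Ξx t (z 0))⁻¹ • (EuclideanSpace.proj (1 : Fin 2) : E² →L[ℝ] ℝ)) z := by
    have hsubx : HasDerivAt (fun a => z 1 - T t a) (-Tx t (z 0)) (z 0) := hTx.const_sub (z 1)
    have hsuby : HasDerivAt (fun b => b - T t (z 0)) 1 (z 1) := (hasDerivAt_id (z 1)).sub_const _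
    have h := hasFDerivAt_coordFun (g := fun a b : ℝ => (b - T t a) * (Ξx t a)⁻¹) hgQ
      (hsubx.mul hinvx) (hsuby.mul_const (Ξx t (z 0))⁻¹)
    simp only [one_mul] at h
    exact h
  have hfun : graphPullback T Ξ Ξx t =
      fun w => vec2 (Ξ t (w 0)) ((w 1 - T t (w 0)) * (Ξx t (w 0))⁻¹) := by
    funext w; rw [graphPullback_apply, div_eq_mul_inv]
  rw [hfun]
  exact hasFDerivAt_vec2 hP hQ

/-! ## Pullback identity, incompressibility, transport -/

/-- **Pullback identity of the graph-band move**: with `Tₜ, Tₓ` the partial derivatives of `T`,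
`Ξₜ, Ξₓ` those of `Ξ`, `Ξₓₓ, Ξₓₜ` those of `Ξₓ` at `(t, z₀)` (`Ξₓₜ` = the time derivative of
`Ξₓ(·, z₀)`, which by symmetry of second derivatives is the `x`-derivative of `Ξₜ(t,·)`, the form
in which it enters the velocity) and `Ξₓ(t, z₀) ≠ 0`, the pair (`graphPullback`, `graphVelocity`
of the rate `g = -Ξₜ/Ξₓ`, its `x`-derivative, and `T, Tₜ, Tₓ`) satisfies `∂ₜΨ + D_zΨ[V] = 0` at
`(t, z)`. First component: `Ξₜ + Ξₓ g = 0`; second component: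
`-(y - T)/Ξₓ² · (Ξₓₜ + Ξₓₓ g + Ξₓ gₓ) = 0`. [folklore] -/
theorem graph_pullback_identity {T Tt Tx Ξ Ξx Ξt Ξxx Ξxt : ℝ → ℝ → ℝ} {t : ℝ} {z : E²}
    (hT : HasDerivAt (fun s => T s (z 0)) (Tt t (z 0)) t)
    (hTx : HasDerivAt (T t) (Tx t (z 0)) (z 0))
    (ht : HasDerivAt (fun s => Ξ s (z 0)) (Ξt t (z 0)) t)
    (hx : HasDerivAt (Ξ t) (Ξx t (z 0)) (z 0))
    (hxx : HasDerivAt (Ξx t) (Ξxx t (z 0)) (z 0))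
    (hxt : HasDerivAt (fun s => Ξx s (z 0)) (Ξxt t (z 0)) t)
    (hne : Ξx t (z 0) ≠ 0) :
    deriv (fun s => graphPullback T Ξ Ξx s z) t +
      fderiv ℝ (graphPullback T Ξ Ξx t) z
        (graphVelocity (axialRate Ξx Ξt) (axialRateDeriv Ξx Ξt Ξxx Ξxt) T Tt Tx t z) = 0 := by
  -- abbreviations for the values of the data at the point
  set X := Ξx t (z 0) with hX
  set S := Ξt t (z 0) with hS
  set XX := Ξxx t (z 0) with hXX
  set XT := Ξxt t (z 0) with hXT
  set A := T t (z 0) with hA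
  set At := Tt t (z 0) with hAt
  set Ax := Tx t (z 0) with hAx
  have hV : graphVelocity (axialRate Ξx Ξt) (axialRateDeriv Ξx Ξt Ξxx Ξxt) T Tt Tx t z =
      vec2 (-S / X) (At + Ax * (-S / X) - (z 1 - A) * (-(XT * X - S * XX) / X ^ 2)) := rfl
  rw [(hasDerivAt_graphPullback hT ht hxt hne).deriv, (hasFDerivAt_graphPullback hTx hx hxx hne).fderiv, hV]
  simp only [_root_.add_apply, ContinuousLinearMap.smulRight_apply, _root_.smul_apply, smul_eq_mul]
  rw [show ((EuclideanSpace.proj (0 : Fin 2) : E² →L[ℝ] ℝ)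
      (vec2 (-S / X) (At + Ax * (-S / X) - (z 1 - A) * (-(XT * X - S * XX) / X ^ 2)))) = -S / X
      from vec2_apply_zero _ _,
    show ((EuclideanSpace.proj (1 : Fin 2) : E² →L[ℝ] ℝ)
      (vec2 (-S / X) (At + Ax * (-S / X) - (z 1 - A) * (-(XT * X - S * XX) / X ^ 2)))) =
        At + Ax * (-S / X) - (z 1 - A) * (-(XT * X - S * XX) / X ^ 2) from vec2_apply_one _ _]
  rw [show ∀ a b : ℝ, a • (EuclideanSpace.single 0 1 : E²) + b • (EuclideanSpace.single 1 1 : E²) =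
      vec2 a b from fun a b => rfl]
  rw [vec2_add_vec2, vec2_eq_zero_iff]
  constructor
  · field_simp
    ring
  · field_simp
    ring

/-- **The graph-band velocity is divergence free**: `∂ₓg + ∂_y(Tₜ + Tₓ g - (y - T) gₓ) = gₓ - gₓ = 0`,
given that `gₓ(t,·)` is the derivative of `g(t,·)` at `z₀` and that the one-dimensional data are
differentiable there. [folklore] -/
theorem divergence_graphVelocity {g gx T Tt Tx : ℝ → ℝ → ℝ} {t : ℝ} {z : E²}
    (hg : HasDerivAt (g t) (gx t (z 0)) (z 0)) (hgx : DifferentiableAt ℝ (gx t) (z 0))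
    (hT : DifferentiableAt ℝ (T t) (z 0)) (hTt : DifferentiableAt ℝ (Tt t) (z 0))
    (hTx : DifferentiableAt ℝ (Tx t) (z 0)) :
    ∑ j, fderiv ℝ (graphVelocity g gx T Tt Tx t) z (EuclideanSpace.single j 1) j = 0 := by
  have hP : HasFDerivAt (fun w : E² => g t (w 0))
      (gx t (z 0) • (EuclideanSpace.proj (0 : Fin 2) : E² →L[ℝ] ℝ)) z :=
    hg.comp_hasFDerivAt z (EuclideanSpace.proj (0 : Fin 2) : E² →L[ℝ] ℝ).hasFDerivAt
  -- the second component as a function of the two coordinates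
  set Q : ℝ → ℝ → ℝ := fun a b => Tt t a + Tx t a * g t a - (b - T t a) * gx t a with hQdef
  have h0 : ∀ {f : ℝ → ℝ}, DifferentiableAt ℝ f (z 0) →
      DifferentiableAt ℝ (fun p : ℝ × ℝ => f p.1) (z 0, z 1) :=
    fun hf => hf.comp (z 0, z 1) differentiableAt_fst
  have hgQ : DifferentiableAt ℝ (uncurry Q) (z 0, z 1) := by
    have e : uncurry Q = fun p : ℝ × ℝ =>
        Tt t p.1 + Tx t p.1 * g t p.1 - (p.2 - T t p.1) * gx t p.1 := by
      funext p; rfl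
    rw [e]
    exact ((h0 hTt).add ((h0 hTx).mul (h0 hg.differentiableAt))).sub
      ((differentiableAt_snd.sub (h0 hT)).mul (h0 hgx))
  have hQa : DifferentiableAt ℝ (fun a => Q a (z 1)) (z 0) :=
    ((hTt.add (hTx.mul hg.differentiableAt)).sub
      (((differentiableAt_const _).sub hT).mul hgx))
  have hQb : HasDerivAt (fun b => Q (z 0) b) (-(1 : ℝ) * gx t (z 0)) (z 1) := by
    have h1 : HasDerivAt (fun b => (b - T t (z 0)) * gx t (z 0)) (1 * gx t (z 0)) (z 1) :=
      ((hasDerivAt_id (z 1)).sub_const _).mul_const _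
    have h2 := h1.const_sub (Tt t (z 0) + Tx t (z 0) * g t (z 0))
    show HasDerivAt (fun b => Tt t (z 0) + Tx t (z 0) * g t (z 0) - (b - T t (z 0)) * gx t (z 0)) _ _
    refine h2.congr_deriv ?_
    ring
  have hQ : HasFDerivAt (fun w : E² => Q (w 0) (w 1))
      (deriv (fun a => Q a (z 1)) (z 0) • (EuclideanSpace.proj (0 : Fin 2) : E² →L[ℝ] ℝ) +
        (-(1 : ℝ) * gx t (z 0)) • (EuclideanSpace.proj (1 : Fin 2) : E² →L[ℝ] ℝ)) z :=
    hasFDerivAt_coordFun hgQ hQa.hasDerivAt hQb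
  rw [show graphVelocity g gx T Tt Tx t = fun w => vec2 (g t (w 0)) (Q (w 0) (w 1)) from rfl,
    divergence_vec2 hP hQ]
  simp

/-- **Transport by a graph-band move**: for every profile `Θ_ref` differentiable at `Ψ(t,z)`,
`Θ_ref ∘ Ψ` is transported at `(t,z)` by the graph-band velocity (hypotheses as in
`graph_pullback_identity`). With `Θ_ref(X, Y) = G(Y)` this is the band around the moving graph;
any velocity that agrees with the graph-band velocity at the point (its cut-off version away from
the band) can be substituted by rewriting. [folklore] -/
theorem transport_comp_graphPullback {Θ : E² → G} {T Tt Tx Ξ Ξx Ξt Ξxx Ξxt : ℝ → ℝ → ℝ}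
    {t : ℝ} {z : E²} (hΘ : DifferentiableAt ℝ Θ (graphPullback T Ξ Ξx t z))
    (hT : HasDerivAt (fun s => T s (z 0)) (Tt t (z 0)) t)
    (hTx : HasDerivAt (T t) (Tx t (z 0)) (z 0))
    (ht : HasDerivAt (fun s => Ξ s (z 0)) (Ξt t (z 0)) t)
    (hx : HasDerivAt (Ξ t) (Ξx t (z 0)) (z 0))
    (hxx : HasDerivAt (Ξx t) (Ξxx t (z 0)) (z 0))
    (hxt : HasDerivAt (fun s => Ξx s (z 0)) (Ξxt t (z 0)) t)
    (hne : Ξx t (z 0) ≠ 0) :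
    deriv (fun s => Θ (graphPullback T Ξ Ξx s z)) t +
      fderiv ℝ (fun w => Θ (graphPullback T Ξ Ξx t w)) z
        (graphVelocity (axialRate Ξx Ξt) (axialRateDeriv Ξx Ξt Ξxx Ξxt) T Tt Tx t z) = 0 :=
  transport_comp_of_pullback hΘ (hasDerivAt_graphPullback hT ht hxt hne).differentiableAt
    (hasFDerivAt_graphPullback hTx hx hxx hne).differentiableAt
    (graph_pullback_identity hT hTx ht hx hxx hxt hne)

/-! ## The stream function -/

/-- **Derivative of the graph-band stream function**:
`D_zH(t,z)[v] = (gₓ (z₁ - T) - g Tₓ - Pₓ) v₀ + g v₁`. [folklore] -/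
theorem hasFDerivAt_graphStream {g gx T Tx P Px : ℝ → ℝ → ℝ} {t : ℝ} {z : E²}
    (hg : HasDerivAt (g t) (gx t (z 0)) (z 0)) (hT : HasDerivAt (T t) (Tx t (z 0)) (z 0))
    (hP : HasDerivAt (P t) (Px t (z 0)) (z 0)) :
    HasFDerivAt (graphStream g T P t)
      ((gx t (z 0) * (z 1 - T t (z 0)) + g t (z 0) * (-Tx t (z 0)) - Px t (z 0)) •
          (EuclideanSpace.proj (0 : Fin 2) : E² →L[ℝ] ℝ) +
        g t (z 0) • (EuclideanSpace.proj (1 : Fin 2) : E² →L[ℝ] ℝ)) z := by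
  have h0 : ∀ {f : ℝ → ℝ}, DifferentiableAt ℝ f (z 0) →
      DifferentiableAt ℝ (fun p : ℝ × ℝ => f p.1) (z 0, z 1) :=
    fun hf => hf.comp (z 0, z 1) differentiableAt_fst
  have hgH : DifferentiableAt ℝ (uncurry fun a b : ℝ => g t a * (b - T t a) - P t a) (z 0, z 1) := by
    have e : (uncurry fun a b : ℝ => g t a * (b - T t a) - P t a) = fun p : ℝ × ℝ =>
        g t p.1 * (p.2 - T t p.1) - P t p.1 := by
      funext p; rfl
    rw [e]
    exact ((h0 hg.differentiableAt).mul (differentiableAt_snd.sub (h0 hT.differentiableAt))).sub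
      (h0 hP.differentiableAt)
  have hHa : HasDerivAt (fun a => g t a * (z 1 - T t a) - P t a)
      (gx t (z 0) * (z 1 - T t (z 0)) + g t (z 0) * (-Tx t (z 0)) - Px t (z 0)) (z 0) := by
    have hsub : HasDerivAt (fun a => z 1 - T t a) (-Tx t (z 0)) (z 0) := hT.const_sub (z 1)
    exact (hg.mul hsub).sub hP
  have hHb : HasDerivAt (fun b => g t (z 0) * (b - T t (z 0)) - P t (z 0)) (g t (z 0)) (z 1) := by
    have h1 : HasDerivAt (fun b => g t (z 0) * (b - T t (z 0))) (g t (z 0) * 1) (z 1) :=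
      ((hasDerivAt_id (z 1)).sub_const _).const_mul _
    simpa using h1.sub_const (P t (z 0))
  have h := hasFDerivAt_coordFun (g := fun a b : ℝ => g t a * (b - T t a) - P t a) hgH hHa hHb
  exact h

/-- **The graph-band velocity is the perpendicular gradient of its stream function**:
`V = (∂_yH, -∂ₓH)` for `H = g (y - T) - P`, provided `∂ₓP(t,·) = Tₜ(t,·)` at the point (the
datum `P(t,·)` is an antiderivative of `∂ₜT(t,·)`). This is the form in which several
simultaneous moves are glued through cut-offs of their stream functions. [folklore] -/
theorem graphVelocity_eq_perp_fderiv_graphStream {g gx T Tt Tx P : ℝ → ℝ → ℝ} {t : ℝ} {z : E²}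
    (hg : HasDerivAt (g t) (gx t (z 0)) (z 0)) (hT : HasDerivAt (T t) (Tx t (z 0)) (z 0))
    (hP : HasDerivAt (P t) (Tt t (z 0)) (z 0)) :
    graphVelocity g gx T Tt Tx t z =
      vec2 (fderiv ℝ (graphStream g T P t) z (EuclideanSpace.single 1 1))
        (-fderiv ℝ (graphStream g T P t) z (EuclideanSpace.single 0 1)) := by
  rw [(hasFDerivAt_graphStream hg hT hP).fderiv, graphVelocity_apply, vec2_eq_vec2_iff]
  simp only [_root_.add_apply, _root_.smul_apply, smul_eq_mul, PiLp.proj_apply,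
    PiLp.single_apply]
  refine ⟨?_, ?_⟩
  · simp
  · simp only [Fin.isValue, one_ne_zero, if_false, if_true, mul_zero, mul_one, add_zero]
    ring

/-! ## Smoothness of the graph-band move -/

section Smoothness

variable {n : WithTop ℕ∞}

/-- **The graph-band pullback is smooth** when `T`, `Ξ` and the (nowhere vanishing) datum `Ξₓ`
are, jointly in `(t, x)`. [folklore] -/
theorem contDiff_uncurry_graphPullback {T Ξ Ξx : ℝ → ℝ → ℝ} (hT : ContDiff ℝ n (uncurry T))
    (hΞ : ContDiff ℝ n (uncurry Ξ)) (hΞx : ContDiff ℝ n (uncurry Ξx)) (hne : ∀ t x, Ξx t x ≠ 0) :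
    ContDiff ℝ n (uncurry (graphPullback T Ξ Ξx)) := by
  have h0 : ContDiff ℝ n fun p : ℝ × E² => ((p.1, p.2 0) : ℝ × ℝ) :=
    contDiff_fst.prodMk ((contDiff_coord 0).comp contDiff_snd)
  have h1 : ContDiff ℝ n fun p : ℝ × E² => uncurry Ξ (p.1, p.2 0) := hΞ.comp h0
  have h2 : ContDiff ℝ n fun p : ℝ × E² =>
      (p.2 1 - uncurry T (p.1, p.2 0)) / uncurry Ξx (p.1, p.2 0) :=
    (((contDiff_coord 1).comp contDiff_snd).sub (hT.comp h0)).div (hΞx.comp h0)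
      fun p => hne p.1 (p.2 0)
  exact contDiff_vec2 h1 h2

/-- **The graph-band velocity is smooth** when its data `g, gₓ, T, Tₜ, Tₓ` are, jointly in
`(t, x)`. [folklore] -/
theorem contDiff_uncurry_graphVelocity {g gx T Tt Tx : ℝ → ℝ → ℝ} (hg : ContDiff ℝ n (uncurry g))
    (hgx : ContDiff ℝ n (uncurry gx)) (hT : ContDiff ℝ n (uncurry T))
    (hTt : ContDiff ℝ n (uncurry Tt)) (hTx : ContDiff ℝ n (uncurry Tx)) :
    ContDiff ℝ n (uncurry (graphVelocity g gx T Tt Tx)) := by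
  have h0 : ContDiff ℝ n fun p : ℝ × E² => ((p.1, p.2 0) : ℝ × ℝ) :=
    contDiff_fst.prodMk ((contDiff_coord 0).comp contDiff_snd)
  have h1 : ContDiff ℝ n fun p : ℝ × E² => uncurry g (p.1, p.2 0) := hg.comp h0
  have h2 : ContDiff ℝ n fun p : ℝ × E² =>
      uncurry Tt (p.1, p.2 0) + uncurry Tx (p.1, p.2 0) * uncurry g (p.1, p.2 0) -
        (p.2 1 - uncurry T (p.1, p.2 0)) * uncurry gx (p.1, p.2 0) :=
    ((hTt.comp h0).add ((hTx.comp h0).mul h1)).sub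
      ((((contDiff_coord 1).comp contDiff_snd).sub (hT.comp h0)).mul (hgx.comp h0))
  exact contDiff_vec2 h1 h2

/-- **The graph-band stream function is smooth** when `g, T, P` are, jointly in `(t, x)`.
[folklore] -/
theorem contDiff_uncurry_graphStream {g T P : ℝ → ℝ → ℝ} (hg : ContDiff ℝ n (uncurry g))
    (hT : ContDiff ℝ n (uncurry T)) (hP : ContDiff ℝ n (uncurry P)) :
    ContDiff ℝ n (uncurry (graphStream g T P)) := by
  have h0 : ContDiff ℝ n fun p : ℝ × E² => ((p.1, p.2 0) : ℝ × ℝ) :=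
    contDiff_fst.prodMk ((contDiff_coord 0).comp contDiff_snd)
  exact ((hg.comp h0).mul (((contDiff_coord 1).comp contDiff_snd).sub (hT.comp h0))).sub
    (hP.comp h0)

/-- **A profile moved by the graph-band pullback is smooth.** [folklore] -/
theorem contDiff_uncurry_comp_graphPullback {Θ : E² → G} {T Ξ Ξx : ℝ → ℝ → ℝ}
    (hΘ : ContDiff ℝ n Θ) (hT : ContDiff ℝ n (uncurry T)) (hΞ : ContDiff ℝ n (uncurry Ξ))
    (hΞx : ContDiff ℝ n (uncurry Ξx)) (hne : ∀ t x, Ξx t x ≠ 0) :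
    ContDiff ℝ n (uncurry fun t z => Θ (graphPullback T Ξ Ξx t z)) :=
  contDiff_uncurry_comp hΘ (contDiff_uncurry_graphPullback hT hΞ hΞx hne)

end Smoothness

end PlanarKinematics

end Literature.Analysis.FluidPDE
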